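/-
Copyright: the b2b-balaban T⁴-continuum CRUX team, row NE7b leaf lineage `t4-ne7b-formalise-leaf-01` (gen 86). Project licence.
-/
import Literature.MathematicalPhysics.QuantumFieldTheory.Balaban1983to89.B6QGQLower276
import Literature.MathematicalPhysics.QuantumFieldTheory.Balaban1983to89.B4Block227

/-!
# THE ZERO-MEAN GAP OF THE HYPERCUBE IS `2`, IN EVERY DIMENSION, AND THE BLOCK FORM OF A CUBE GAP:
# `2·(Σ_y g_y² − (Σ_y g_y)²∕2^d) ≤ Σ_μ Σ_{y : y_μ = 0} (g(y + e_μ) − g y)²` on `{0,1}^d`, and for blocks of side `n + 1` on `ℤ^d`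
# `(∀ g, Σ g = 0 → c·Σ g² ≤ E_cube g) → (∀ y u, Σ_{B(y)} u = 0 → c·Σ_{B(y)} u² ≤ Σ_{q∈B(y)} Σ_μ [loc_μ q < n]·(u q − u(q+e_μ))²)`
# (row NE7b, node U5c; the coercivity input `hgap` of this lineage's `BlockSectionAgmonEngine`, BY VALUE; [folklore] over `B6QGQLower276` ∕ `Beta.CoordCubePoincare`)

Cell `pub-balaban`, sub-cell `t4`, spine estimate NE7b (`T4WeightBudget.RelWeightBound`; the cell's OWN estimate — NOT PRINTED in
[Bałaban 1983–89], NOT PROVED).  Crux-route work under `Spine/NE7b/` by a row leaf (`t4-ne7b-formalise-leaf-01` gen 86) under FREEZE (0)'s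
crux-prover clause; NOTHING of Bałaban's is named as a Lean object, valued or asserted; no `T4Continuum/Support` leaf typed; no `def`; zero `sorry`.
Import: `Literature.….B6QGQLower276` ONLY (sites `X d = ℤ^d`, blocks `B n y` with charts `chart n y : (Fin d → Fin (n+1)) → X d`, `loc`, `e`,
`chart_stepUp`; through it `Beta.CoordCubePoincare` — the function cube `Fin d → Fin (n+1)` with bonds `y ↦ stepUp y μ`, `sum_cons`,
`stepUp_cons_zero ∕ _succ`, and the tree's cube Poincaré letter `sum_sq_le_of_sum_eq_zero_coordCube` with the path constant `n(n+1)∕2`) and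
`Literature.….B4Block227` (the tree's SHARPER cube letter `sum_sq_le_of_sum_eq_zero_coordCube8`: constant `(n+1)²∕8`, i.e. gap `8∕(n+1)²` for every side —
`= 2` at side 2; located by the chair, leaf-04 g159 δ-X-HBG-1).

WHY.  The engine of this lineage's a-posteriori Agmon letter (`BlockSectionAgmonEngine.engine`, its read on the one-shot section
`BlockSectionAgmonLetter.agmon_kerH` ∕ `rowSum_kerH_le_of_residual`) carries the intra-block coercivity as the DISPLAYED hypothesis
`hgap : ∀ y u, Σ_{B(y)} u = 0 → gap·Σ_{B(y)} u² ≤ Σ_{q∈B(y)} Σ_μ [loc_μ q < n]·(u q − u(q + e_μ))²`, and the letter's constant is `gap − d·η`.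
The tree's cube letters give `gap = 2∕(n(n+1))` (`CoordCubePoincare`, `= 1` at side 2) and `gap = 8∕(n+1)²` (`B4Block227`, `= 2` at side 2, `8∕9` at side 3,
`1∕2` at side 4 — the best `hgap` in the tree for sides `> 2`, here as `blockGap_eight`); THIS FILE proves the side-2 value `2` in MEAN form directly (the
zero-mean spectral gap of the hypercube graph `{0,1}^d` is `2` in every dimension — induction on `d`: split along the first coordinate, the
`2^{d−1}` rungs give `Σ(g₁ − g₀)² ≥ (s₁ − s₀)²∕2^{d−1}` by Cauchy–Schwarz, the two facets give the induction hypothesis, and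
`2(s₀² + s₁²) − (s₀ − s₁)² = (s₀ + s₁)²`) and the TRANSPORT of any cube letter to the engine's block form (charts: `loc_μ(chart y z) = z_μ`,
`chart y z + e_μ = chart y (stepUp z μ)` below the face).  BY VALUE at side 2, `d = 4`, weight slope `t = 3∕2` (`η = 1∕12`): `gap − dη = 5∕3`
with this file's `2`, against `2∕3` with the path constant — the certificate's error term is `2.5×` smaller.

WHAT IS PROVED (all [folklore]):
* §1 **`hypercubeGap_mean`** — every `d`, every `g : (Fin d → Fin 2) → ℝ`:
  `2·Σ_y g_y² ≤ 2·(Σ_y g_y)²∕2^d + Σ_μ Σ_{y : y_μ ≠ last} (g(stepUp y μ) − g y)²`; **`hypercubeGap`** (zero-sum form: `2·Σ g² ≤ E`).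
* §2 **`blockGap_of_cubeGap`** — any side `n + 1`, any constant `c`: a zero-sum cube letter `c·Σ g² ≤ E_cube(g)` gives the engine's `hgap` with `gap = c`;
  **`blockGap_two`** (`n = 1`, `gap = 2`, from §1), **`blockGap_path`** (any `n`, `gap = 2∕(n(n+1))`, from the tree's
  `sum_sq_le_of_sum_eq_zero_coordCube` BY NAME) and **`blockGap_eight`** (any `n`, `gap = 8∕(n+1)²`, from the tree's `B4Block227.sum_sq_le_of_sum_eq_zero_coordCube8`
  BY NAME — sharper for every side `≥ 3`, equal to `blockGap_two`'s `2` at side 2).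

HONEST: [folklore] graph spectral gap; nothing of Bałaban's; no number beyond `2` and `2∕(n(n+1))`; BY-NAME EFFECT ON THE WALL: NONE.  NE7b NOT
PRINTED ∕ NOT PROVED; spine PROVED 0∕9; rung (B)+1 on a FINITE torus — NOT infinite volume, NOT the mass gap, NOT Clay.  HONEST DEPENDENCY: continuum
YM on T⁴ ⇐ BetaPertH ∧ nine spine estimates (0∕9 proved); BetaPertH ⇐ (D1) ∧ (D4) ∧ CAP+tail; G-an2-4 gates asym, D1 and NE2∕3∕4.
-/

set_option autoImplicit false

namespace Summit.QuantumFields.BalabanUV.T4Continuum.NE7b.HypercubeBlockGap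

open Finset
open Literature.MathematicalPhysics.QuantumFieldTheory.Balaban1983to89
open B6QGQLower276 (X B e loc chart sum_B loc_chart chart_stepUp)
open Beta.CoordCubePoincare (stepUp stepUp_cons_zero stepUp_cons_succ sum_cons sum_sq_le_of_sum_eq_zero_coordCube)
open B4Block227 (sum_sq_le_of_sum_eq_zero_coordCube8)

noncomputable section

variable {d : ℕ}

/-! ## §1  The hypercube `{0,1}^d`: zero-mean gap `2` [folklore] -/

/-- **THE HYPERCUBE GAP, MEAN FORM**: for every `d` and every `g : (Fin d → Fin 2) → ℝ`,
`2·Σ_y g_y² ≤ 2·(Σ_y g_y)²∕2^d + Σ_μ Σ_{y : y_μ ≠ last}(g(y + e_μ) − g y)²` (equality for affine `g`).  Induction on `d` along the first coordinate: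
rungs by Cauchy–Schwarz, facets by the induction hypothesis, `2(s₀² + s₁²) − (s₀ − s₁)² = (s₀ + s₁)²`. [folklore] -/
theorem hypercubeGap_mean : ∀ (d : ℕ) (g : (Fin d → Fin 2) → ℝ),
    2 * ∑ y, g y ^ 2 ≤ 2 * (∑ y, g y) ^ 2 / 2 ^ d +
      ∑ μ : Fin d, ∑ y ∈ univ.filter (fun y : Fin d → Fin 2 => y μ ≠ Fin.last 1), (g (stepUp y μ) - g y) ^ 2
  | 0, g => by simp
  | d + 1, g => by
    -- the two facets
    set g₀ : (Fin d → Fin 2) → ℝ := fun p => g (Fin.cons 0 p) with hg₀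
    set g₁ : (Fin d → Fin 2) → ℝ := fun p => g (Fin.cons 1 p) with hg₁
    have IH₀ := hypercubeGap_mean d g₀
    have IH₁ := hypercubeGap_mean d g₁
    have h2 : ∀ G : Fin 2 → ℝ, ∑ a, G a = G 0 + G 1 := fun G => Fin.sum_univ_two G
    -- sums split along the first coordinate
    have hsum : ∑ y, g y = ∑ p, g₀ p + ∑ p, g₁ p := by rw [sum_cons, h2]
    have hsq : ∑ y, g y ^ 2 = ∑ p, g₀ p ^ 2 + ∑ p, g₁ p ^ 2 := by
      rw [sum_cons (fun y => g y ^ 2), h2]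
    -- the energy splits into the rungs (direction `0`) and the two facets (directions `succ ν`)
    have hrung : ∑ y ∈ univ.filter (fun y : Fin (d + 1) → Fin 2 => y 0 ≠ Fin.last 1), (g (stepUp y 0) - g y) ^ 2 =
        ∑ p, (g₁ p - g₀ p) ^ 2 := by
      rw [Finset.sum_filter, sum_cons, h2]
      have h1 : ∀ p : Fin d → Fin 2, ¬ ((Fin.cons 1 p : Fin (d + 1) → Fin 2) 0 ≠ Fin.last 1) := fun p => by
        rw [Fin.cons_zero]; decide
      simp only [h1, if_false, Finset.sum_const_zero, add_zero, stepUp_cons_zero]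
      refine Finset.sum_congr rfl fun p _ => ?_
      simp only [hg₀, hg₁]
      rfl
    have hfacet : ∀ ν : Fin d,
        ∑ y ∈ univ.filter (fun y : Fin (d + 1) → Fin 2 => y ν.succ ≠ Fin.last 1), (g (stepUp y ν.succ) - g y) ^ 2 =
          ∑ p ∈ univ.filter (fun p : Fin d → Fin 2 => p ν ≠ Fin.last 1), (g₀ (stepUp p ν) - g₀ p) ^ 2 +
            ∑ p ∈ univ.filter (fun p : Fin d → Fin 2 => p ν ≠ Fin.last 1), (g₁ (stepUp p ν) - g₁ p) ^ 2 := by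
      intro ν
      rw [Finset.sum_filter, Finset.sum_filter, Finset.sum_filter, sum_cons, h2]
      simp only [Fin.cons_succ, stepUp_cons_succ, hg₀, hg₁]
    have hE : ∑ μ : Fin (d + 1), ∑ y ∈ univ.filter (fun y : Fin (d + 1) → Fin 2 => y μ ≠ Fin.last 1),
          (g (stepUp y μ) - g y) ^ 2 =
        ∑ p, (g₁ p - g₀ p) ^ 2 +
          (∑ ν : Fin d, ∑ p ∈ univ.filter (fun p : Fin d → Fin 2 => p ν ≠ Fin.last 1), (g₀ (stepUp p ν) - g₀ p) ^ 2 +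
            ∑ ν : Fin d, ∑ p ∈ univ.filter (fun p : Fin d → Fin 2 => p ν ≠ Fin.last 1), (g₁ (stepUp p ν) - g₁ p) ^ 2) := by
      rw [Fin.sum_univ_succ, hrung, Finset.sum_congr rfl fun ν _ => hfacet ν, Finset.sum_add_distrib]
    -- Cauchy–Schwarz on the rungs
    have hN : (0 : ℝ) < 2 ^ d := by positivity
    have hCS : (∑ p, g₁ p - ∑ p, g₀ p) ^ 2 ≤ 2 ^ d * ∑ p, (g₁ p - g₀ p) ^ 2 := by
      have h := sq_sum_le_card_mul_sum_sq (s := (Finset.univ : Finset (Fin d → Fin 2))) (f := fun p => g₁ p - g₀ p)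
      rw [Finset.sum_sub_distrib] at h
      simpa [Finset.card_univ, Fintype.card_fun, Fintype.card_fin] using h
    -- assemble
    rw [hsq, hsum, hE]
    have hkey : 2 * ((∑ p, g₀ p) ^ 2 + (∑ p, g₁ p) ^ 2) / 2 ^ d =
        2 * (∑ p, g₀ p + ∑ p, g₁ p) ^ 2 / 2 ^ (d + 1) + (∑ p, g₁ p - ∑ p, g₀ p) ^ 2 / 2 ^ d := by
      rw [pow_succ]
      field_simp
      ring
    have hCS' : (∑ p, g₁ p - ∑ p, g₀ p) ^ 2 / 2 ^ d ≤ ∑ p, (g₁ p - g₀ p) ^ 2 := by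
      rw [div_le_iff₀ hN]; linarith [hCS]
    have hIH : 2 * (∑ p, g₀ p ^ 2 + ∑ p, g₁ p ^ 2) ≤ 2 * ((∑ p, g₀ p) ^ 2 + (∑ p, g₁ p) ^ 2) / 2 ^ d +
        (∑ ν : Fin d, ∑ p ∈ univ.filter (fun p : Fin d → Fin 2 => p ν ≠ Fin.last 1), (g₀ (stepUp p ν) - g₀ p) ^ 2 +
          ∑ ν : Fin d, ∑ p ∈ univ.filter (fun p : Fin d → Fin 2 => p ν ≠ Fin.last 1), (g₁ (stepUp p ν) - g₁ p) ^ 2) := by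
      have : 2 * ((∑ p, g₀ p) ^ 2 + (∑ p, g₁ p) ^ 2) / 2 ^ d = 2 * (∑ p, g₀ p) ^ 2 / 2 ^ d + 2 * (∑ p, g₁ p) ^ 2 / 2 ^ d := by
        ring
      rw [this]; linarith [IH₀, IH₁]
    rw [hkey] at hIH
    linarith [hIH, hCS']

/-- **THE HYPERCUBE GAP, ZERO-SUM FORM**: `Σ_y g y = 0 ⟹ 2·Σ_y g_y² ≤ Σ_μ Σ_{y : y_μ ≠ last}(g(y + e_μ) − g y)²` — the zero-mean spectral gap of
the hypercube graph is `2`, in every dimension (sharp: `g y = (−1)^{y_0}`). [folklore] -/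
theorem hypercubeGap (d : ℕ) (g : (Fin d → Fin 2) → ℝ) (h0 : ∑ y, g y = 0) :
    2 * ∑ y, g y ^ 2 ≤ ∑ μ : Fin d, ∑ y ∈ univ.filter (fun y : Fin d → Fin 2 => y μ ≠ Fin.last 1), (g (stepUp y μ) - g y) ^ 2 := by
  have h := hypercubeGap_mean d g
  rw [h0] at h
  simpa using h

/-! ## §2  Transport to blocks of `ℤ^d`: the engine's `hgap` [folklore] -/

/-- **BLOCK FORM OF A CUBE LETTER**: for blocks of side `n + 1`, a zero-sum cube letter `c·Σ_z g_z² ≤ Σ_μ Σ_{z_μ ≠ last}(g(z + e_μ) − g z)²`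
(for every `g : (Fin d → Fin (n+1)) → ℝ`) gives, on every block `B(y)` and every `u : ℤ^d → ℝ` with `Σ_{B(y)} u = 0`,
`c·Σ_{q∈B(y)} u_q² ≤ Σ_{q∈B(y)} Σ_μ [loc_μ q < n]·(u q − u(q + e_μ))²` — LITERALLY the `hgap` of `BlockSectionAgmonEngine.engine`. [folklore] -/
theorem blockGap_of_cubeGap (n : ℕ) (c : ℝ)
    (hcube : ∀ g : (Fin d → Fin (n + 1)) → ℝ, ∑ z, g z = 0 →
      c * ∑ z, g z ^ 2 ≤ ∑ μ : Fin d, ∑ z ∈ univ.filter (fun z : Fin d → Fin (n + 1) => z μ ≠ Fin.last n), (g (stepUp z μ) - g z) ^ 2)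
    (y : X d) (u : X d → ℝ) (hu : ∑ q ∈ B n y, u q = 0) :
    c * ∑ q ∈ B n y, u q ^ 2 ≤ ∑ q ∈ B n y, ∑ μ : Fin d, (if loc n q μ < n then (u q - u (q + e μ)) ^ 2 else 0) := by
  classical
  set g : (Fin d → Fin (n + 1)) → ℝ := fun z => u (chart n y z) with hg
  have h0 : ∑ z, g z = 0 := by rw [← hu, sum_B]
  have h := hcube g h0
  rw [sum_B y (fun q => u q ^ 2), sum_B y]
  -- rewrite the block side: `loc_μ(chart y z) < n ↔ z μ ≠ last`, `chart y z + e_μ = chart y (stepUp z μ)`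
  have hface : ∀ (z : Fin d → Fin (n + 1)) (μ : Fin d), loc n (chart n y z) μ < n ↔ z μ ≠ Fin.last n := by
    intro z μ
    rw [loc_chart, ne_eq, Fin.ext_iff, Fin.val_last]
    have := (z μ).2
    constructor
    · intro h; omega
    · intro h; omega
  have hrhs : ∑ z : Fin d → Fin (n + 1), ∑ μ : Fin d, (if loc n (chart n y z) μ < n then
      (u (chart n y z) - u (chart n y z + e μ)) ^ 2 else 0) =
      ∑ μ : Fin d, ∑ z ∈ univ.filter (fun z : Fin d → Fin (n + 1) => z μ ≠ Fin.last n), (g (stepUp z μ) - g z) ^ 2 := by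
    rw [Finset.sum_comm]
    refine Finset.sum_congr rfl fun μ _ => ?_
    rw [Finset.sum_filter]
    refine Finset.sum_congr rfl fun z _ => ?_
    by_cases hz : z μ ≠ Fin.last n
    · rw [if_pos ((hface z μ).2 hz), if_pos hz, ← chart_stepUp n y hz, hg]
      ring
    · rw [if_neg (fun h' => hz ((hface z μ).1 h')), if_neg hz]
  rw [hrhs]
  exact h

/-- **SIDE 2: `gap = 2`** — the engine's `hgap` at `n = 1` with the sharp hypercube constant. [folklore] -/
theorem blockGap_two (y : X d) (u : X d → ℝ) (hu : ∑ q ∈ B 1 y, u q = 0) :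
    2 * ∑ q ∈ B 1 y, u q ^ 2 ≤ ∑ q ∈ B 1 y, ∑ μ : Fin d, (if loc 1 q μ < 1 then (u q - u (q + e μ)) ^ 2 else 0) :=
  blockGap_of_cubeGap 1 2 (fun g hg => hypercubeGap d g hg) y u hu

/-- **ANY SIDE: `gap = 2∕(n(n+1))`** — the engine's `hgap` from the tree's cube Poincaré letter `sum_sq_le_of_sum_eq_zero_coordCube`
(path constant `n(n+1)∕2`, `d`-free; at side 2 this is `1`, half the sharp value of `blockGap_two`). [folklore] -/
theorem blockGap_path (n : ℕ) (hn : 1 ≤ n) (y : X d) (u : X d → ℝ) (hu : ∑ q ∈ B n y, u q = 0) :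
    2 / ((n : ℝ) * (n + 1)) * ∑ q ∈ B n y, u q ^ 2 ≤
      ∑ q ∈ B n y, ∑ μ : Fin d, (if loc n q μ < n then (u q - u (q + e μ)) ^ 2 else 0) := by
  refine blockGap_of_cubeGap n _ (fun g hg => ?_) y u hu
  have h := sum_sq_le_of_sum_eq_zero_coordCube n d g hg
  have hpos : (0 : ℝ) < (n : ℝ) * (n + 1) / 2 := by
    have : (1 : ℝ) ≤ n := by exact_mod_cast hn
    positivity
  rw [div_mul_eq_mul_div, div_le_iff₀ (by positivity : (0 : ℝ) < (n : ℝ) * (n + 1))]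
  calc 2 * ∑ z, g z ^ 2 ≤ 2 * ((n : ℝ) * (n + 1) / 2 *
        ∑ μ : Fin d, ∑ z ∈ univ.filter (fun z : Fin d → Fin (n + 1) => z μ ≠ Fin.last n), (g (stepUp z μ) - g z) ^ 2) := by
        linarith [h]
    _ = (∑ μ : Fin d, ∑ z ∈ univ.filter (fun z : Fin d → Fin (n + 1) => z μ ≠ Fin.last n), (g (stepUp z μ) - g z) ^ 2) *
        ((n : ℝ) * (n + 1)) := by ring

/-- **ANY SIDE: `gap = 8∕(n+1)²`** — the engine's `hgap` from the tree's sharper cube letter `B4Block227.sum_sq_le_of_sum_eq_zero_coordCube8`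
(constant `(n+1)²∕8`; `= 2` at side 2, `8∕9` at side 3, `1∕2` at side 4 — located by the chair leaf-04 g159, δ-X-HBG-1). [folklore] -/
theorem blockGap_eight (n : ℕ) (y : X d) (u : X d → ℝ) (hu : ∑ q ∈ B n y, u q = 0) :
    8 / ((n : ℝ) + 1) ^ 2 * ∑ q ∈ B n y, u q ^ 2 ≤
      ∑ q ∈ B n y, ∑ μ : Fin d, (if loc n q μ < n then (u q - u (q + e μ)) ^ 2 else 0) := by
  refine blockGap_of_cubeGap n _ (fun g hg => ?_) y u hu
  have h := sum_sq_le_of_sum_eq_zero_coordCube8 n d g hg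
  have hpos : (0 : ℝ) < ((n : ℝ) + 1) ^ 2 := by positivity
  rw [div_mul_eq_mul_div, div_le_iff₀ hpos]
  calc 8 * ∑ z, g z ^ 2 ≤ 8 * (((n : ℝ) + 1) ^ 2 / 8 *
        ∑ μ : Fin d, ∑ z ∈ univ.filter (fun z : Fin d → Fin (n + 1) => z μ ≠ Fin.last n), (g (stepUp z μ) - g z) ^ 2) := by
        linarith [h]
    _ = (∑ μ : Fin d, ∑ z ∈ univ.filter (fun z : Fin d → Fin (n + 1) => z μ ≠ Fin.last n), (g (stepUp z μ) - g z) ^ 2) *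
        ((n : ℝ) + 1) ^ 2 := by ring

end

end Summit.QuantumFields.BalabanUV.T4Continuum.NE7b.HypercubeBlockGap
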